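import Literature.AlgebraicGeometry.AbelianSchemes.AbelianSchemeConstSubgroupQuotientSmooth
import Literature.AlgebraicGeometry.RelativeSpec.GeometricQuotientFreeEtale
import Literature.AlgebraicGeometry.Morphisms.RelDimOfEtaleSurjectiveComp
import HarnessLib

/-!
# The quotient map `ψ : A → A/K` by a free finite group of translations is ÉTALE, and `A/K → S` has the relative
# dimension of `A → S`

Continuation of `AbelianSchemes/AbelianSchemeConstSubgroupQuotientSmooth` (★ `flat_quotientMk_left`,
`surjective_quotientMk_left`, `smooth_quotientOver_hom`) for Mumford's glued quotient `A/K → S` of an abelian scheme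
`A → S` by a finite subgroup `K ⊂ A(S)` of sections acting freely on geometric points (`hfree`), quotient map
`ψ = quotientMk : A → A/K` (`AbelianSchemes/AbelianSchemeConstSubgroupQuotient`).  THEOREMS ONLY; no definition, no
named fact, no instance.  Cell hodgecm-mathlib (D-0151), Hecke-link socket (B), LACK #5 of the quotient-triple census
(the field `relDim : (A′/K₀).IsOfRelDim g` of `PolarizedAbelianSchemeWithLevel`):

* `etale_quotientMk_left` — **`ψ` is étale**: over an affine auxiliary base `Y`, `ψ` is an affine geometric quotient
  (★ `isGeometricQuotient_quotientActionOver`) by a FREE finite group action (★ `quotientActionOver_free`), hence étale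
  (★ `RelativeSpec.ActionOver.IsGeometricQuotient.etale_of_free`: chartwise a Galois extension of rings,
  Chase–Harrison–Rosenberg; SGA 1 V Cor. 2.4 / Prop. 2.6 — `A` is an étale `K`-torsor over `A/K`, Mumford §7 Thm. 4,
  §12 Thm. 1); `etale_quotientMk_left'` — the same on the `quotientBy`-typed spelling of `ψ`;
* `smoothOfRelativeDimension_quotientOver_hom` — **`A/K → S` is smooth of relative dimension `g`** when `A → S` is
  (`A.IsOfRelDim g`) and `A/K → S` is smooth: the relative dimension descends along the étale surjective `ψ`
  (★ `Morphisms.smoothOfRelativeDimension_of_comp_eq_of_etale`, EGA IV₄ 17.7.7 with 17.10.2);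
* `isOfRelDim_quotientBy` — **`(A.quotientBy u K hcov hG hsm hgc).IsOfRelDim g`** from `A.IsOfRelDim g` (the consumer
  shape: `(hB : B.IsOfRelDim g)` of ★ `LevelStructureOfHeckeQuotient` / `SymplecticLiftOfIsogenyQuotient`).

## References

* [SGA1] A. Grothendieck, *SGA 1*, Exp. V, Cor. 2.4, Prop. 2.6, Déf. 2.7.
* [MumfordAV1970] D. Mumford, *Abelian Varieties* (1970), §7 Thm. 4 (p. 72); §12 Thm. 1 (p. 112).
* [Grothendieck1967] A. Grothendieck, *EGA IV₄*, Prop. 17.7.7 and 17.10.2.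
-/

noncomputable section

universe u

open CategoryTheory CategoryTheory.Limits AlgebraicGeometry MonoidalCategory CartesianMonoidalCategory
open scoped MonObj

namespace Literature.AlgebraicGeometry.AbelianSchemes

namespace AbelianSchemeOver

section Etale

variable {S : Scheme.{u}} (A : AbelianSchemeOver S) {Y : Scheme.{u}} (u : S ⟶ Y) (K : Subgroup A.Sections)
  [Finite K] [Y.IsSeparated] [IsSeparated (A.X.hom ≫ u)] [S.IsSeparated]
  (hcov : ∀ x : A.left, ∃ O : (A.translationActionOver u K).StableAffineOpens, x ∈ O.1)

/-- **`ψ : A → A/K` is étale** for a finite subgroup `K` of sections none of whose non-trivial translations fixes a geometric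
point of `A` (a free action, hypothesis `hfree`): an affine geometric quotient by a free finite group action is étale — `A` is an
étale `K`-torsor over `A/K`. [cite: SGA1, Exp. V Cor. 2.4, Prop. 2.6] [cite: MumfordAV1970, §12 Thm. 1 (p. 112)] -/
theorem etale_quotientMk_left [IsAffine Y]
    (hfree : ∀ (Ω : Type u) [Field Ω] [IsAlgClosed Ω] (x : Spec (.of Ω) ⟶ A.left) (σ : K), σ ≠ 1 →
      x ≫ (A.translation (σ : A.Sections)).left ≠ x) :
    Etale (A.quotientMk u K hcov).left := by
  haveI := Fintype.ofFinite K
  haveI := A.isAffineHom_quotientMk_left u K hcov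
  exact (A.isGeometricQuotient_quotientActionOver u K hcov).etale_of_free (A.quotientActionOver_free u K hcov hfree)

include hcov in
/-- **`A/K → S` is smooth of relative dimension `g`** when `A → S` is (`A.IsOfRelDim g`) and `A/K → S` is smooth (`hsm`, ★
`smooth_quotientOver_hom`): `ψ : A → A/K` is étale and surjective with `ψ ≫ (A/K → S) = (A → S)`, and the relative dimension
descends along an étale surjective morphism of the source (EGA IV₄ 17.7.7 / 17.10.2, ★
`Morphisms.smoothOfRelativeDimension_of_comp_eq_of_etale`). [cite: Grothendieck1967, Prop. 17.7.7 and 17.10.2]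
[cite: MumfordAV1970, §7 Thm. 4 (p. 72)] -/
theorem smoothOfRelativeDimension_quotientOver_hom [IsAffine Y]
    (hfree : ∀ (Ω : Type u) [Field Ω] [IsAlgClosed Ω] (x : Spec (.of Ω) ⟶ A.left) (σ : K), σ ≠ 1 →
      x ≫ (A.translation (σ : A.Sections)).left ≠ x)
    (hsm : Smooth (A.quotientOver u K).hom) {g : ℕ} (hA : A.IsOfRelDim g) :
    SmoothOfRelativeDimension g (A.quotientOver u K).hom := by
  haveI := A.etale_quotientMk_left u K hcov hfree
  haveI := A.surjective_quotientMk_left u K hcov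
  haveI := hsm
  haveI : SmoothOfRelativeDimension g A.X.hom := (A.isOfRelDim_iff g).mp hA
  exact Morphisms.smoothOfRelativeDimension_of_comp_eq_of_etale (A.quotientMk u K hcov).left (A.quotientOver u K).hom
    A.X.hom (Over.w (A.quotientMk u K hcov)) g

end Etale

section QuotientBy

variable {S : Scheme.{u}} (A : AbelianSchemeOver S) {Y : Scheme.{u}} (u : S ⟶ Y) (K : Subgroup A.Sections)
  [Finite K] [Y.IsSeparated] [IsSeparated (A.X.hom ≫ u)] [S.IsSeparated]
  (hcov : ∀ x : A.left, ∃ O : (A.translationActionOver u K).StableAffineOpens, x ∈ O.1)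
  [LocallyOfFiniteType (A.X.hom ≫ u)] [IsLocallyNoetherian Y]
  (hG : ∃ _ : GrpObj (A.quotientOver u K), IsMonHom (A.quotientMk u K hcov))
  (hsm : Smooth (A.quotientOver u K).hom) (hgc : GeometricallyConnected (A.quotientOver u K).hom)

/-- `ψ : A → A/K` is étale, on the `quotientBy`-typed spelling of `ψ` (★ `etale_quotientMk_left`).
[cite: SGA1, Exp. V Cor. 2.4, Prop. 2.6] -/
theorem etale_quotientMk_left' [IsAffine Y]
    (hfree : ∀ (Ω : Type u) [Field Ω] [IsAlgClosed Ω] (x : Spec (.of Ω) ⟶ A.left) (σ : K), σ ≠ 1 →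
      x ≫ (A.translation (σ : A.Sections)).left ≠ x) :
    Etale (show A.X ⟶ (A.quotientBy u K hcov hG hsm hgc).X from A.quotientMk u K hcov).left :=
  A.etale_quotientMk_left u K hcov hfree

/-- **The abelian scheme `A/K` has relative dimension `g` if `A` does**: `(A.quotientBy u K hcov hG hsm hgc).IsOfRelDim g` from
`A.IsOfRelDim g` (★ `smoothOfRelativeDimension_quotientOver_hom`; the underlying `S`-scheme of `quotientBy` is `quotientOver`).
This is the field `relDim` of the quotient triple `(A/K, λ̄, φ̄)`. [cite: MumfordAV1970, §7 Thm. 4 (p. 72)]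
[cite: Grothendieck1967, Prop. 17.7.7 and 17.10.2] -/
theorem isOfRelDim_quotientBy [IsAffine Y]
    (hfree : ∀ (Ω : Type u) [Field Ω] [IsAlgClosed Ω] (x : Spec (.of Ω) ⟶ A.left) (σ : K), σ ≠ 1 →
      x ≫ (A.translation (σ : A.Sections)).left ≠ x) {g : ℕ} (hA : A.IsOfRelDim g) :
    (A.quotientBy u K hcov hG hsm hgc).IsOfRelDim g :=
  ((A.quotientBy u K hcov hG hsm hgc).isOfRelDim_iff g).mpr
    (A.smoothOfRelativeDimension_quotientOver_hom u K hcov hfree hsm hA)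

end QuotientBy

end AbelianSchemeOver

end Literature.AlgebraicGeometry.AbelianSchemes

end
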